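import Literature.NumberTheory.LFunctions.FordSmoothNumbers
import Literature.NumberTheory.LFunctions.FordZetaBoundKappa12
import Mathlib.Analysis.SpecialFunctions.Pow.Deriv
import Mathlib.Analysis.Calculus.Deriv.MeanValue
import HarnessLib

/-!
# Elementary inequalities for Ford's Lemma 4.2

Topic `Literature/NumberTheory/LFunctions`. Everything here is PROVED.

K. Ford, Proc. LMS 85 (2002), Lemma 4.2: this file provides the elementary inputs of the induction
(4.13) — the bounds (4.15) for `α^ℓ = (1 − 1/h)^ℓ`, the smooth-number bound (4.14) in the form
`|𝒞(M,R)| ≤ M(2.2ν)^{1/ν}` (`FordVK.card_C_le_nu`, from `FordSmooth.card_smoothSet_le`), the sum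
`∑_{a<q≤b} q^E ≤ b^{E+1}/(E+1)`, Ford's function `f_j` and its bounds, the range
`−5/8 ≤ E ≤ −1/2` of the exponent in the `q`-sum, and the numerical absorption `FordVK.absorb_T2`
for the second term of Lemma 4.1 (constants `8/3, 2.2, 12` of this library in place of Ford's
`4, 2, 10`). The parameters `P_j, M_j, η₁, Δ_j, E_j` themselves are in `FordIncompleteLemma42`.

## References

* K. Ford, Proc. London Math. Soc. (3) 85 (2002), 565–633, Lemma 4.2 and its proof,
  (4.9)–(4.10), (4.14), (4.15). [Ford2002]
-/

noncomputable section

open Finset Real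

namespace Literature.NumberTheory.LFunctions
namespace FordVK

open FordSmooth

/-! ### (4.15): `1 − ℓ/h ≤ α^ℓ ≤ e^{-ℓ/h} ≤ 1 − ℓ/h + ℓ²/(2h²)` -/

/-- `(1 − 1/h)^ℓ ≥ 1 − ℓ/h` (Bernoulli). [cite: Ford2002, (4.15)] -/
theorem alpha_pow_ge {h : ℝ} (hh : 1 ≤ h) (ℓ : ℕ) : 1 - (ℓ : ℝ) / h ≤ (1 - 1 / h) ^ ℓ := by
  have := one_add_mul_le_pow (show (-2 : ℝ) ≤ -(1 / h) by
    have : 1 / h ≤ 1 := by rw [div_le_one (by linarith)]; exact hh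
    linarith) ℓ
  calc 1 - (ℓ : ℝ) / h = 1 + (ℓ : ℝ) * (-(1 / h)) := by ring
    _ ≤ (1 + -(1 / h)) ^ ℓ := this
    _ = (1 - 1 / h) ^ ℓ := by ring

/-- `(1 − 1/h)^ℓ ≤ e^{-ℓ/h}`. [cite: Ford2002, (4.15)] -/
theorem alpha_pow_le_exp {h : ℝ} (hh : 1 ≤ h) (ℓ : ℕ) : (1 - 1 / h) ^ ℓ ≤ Real.exp (-(ℓ : ℝ) / h) := by
  have h0 : 0 ≤ 1 - 1 / h := by
    have : 1 / h ≤ 1 := by rw [div_le_one (by linarith)]; exact hh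
    linarith
  have h1 : 1 - 1 / h ≤ Real.exp (-(1 / h)) := by
    have := Real.add_one_le_exp (-(1 / h)); linarith
  calc (1 - 1 / h) ^ ℓ ≤ (Real.exp (-(1 / h))) ^ ℓ := pow_le_pow_left₀ h0 h1 ℓ
    _ = Real.exp (-(ℓ : ℝ) / h) := by rw [← Real.exp_nat_mul]; congr 1; ring

/-- `(1 − 1/h)^ℓ ≤ 1 − ℓ/h + ℓ²/(2h²)`. [cite: Ford2002, (4.15)] -/
theorem alpha_pow_le_quadratic {h : ℝ} (hh : 1 ≤ h) (ℓ : ℕ) :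
    (1 - 1 / h) ^ ℓ ≤ 1 - (ℓ : ℝ) / h + (ℓ : ℝ) ^ 2 / (2 * h ^ 2) := by
  refine (alpha_pow_le_exp hh ℓ).trans ?_
  have := exp_neg_le_taylor2 (x := (ℓ : ℝ) / h) (by positivity)
  rw [show -(ℓ : ℝ) / h = -((ℓ : ℝ) / h) by ring]
  refine this.trans (le_of_eq ?_)
  field_simp

/-! ### (4.14): `|𝒞(M,R)| ≤ M (2.2ν)^{1/ν}`, `ν = log R / log M` -/

/-- **(4.14) with the constant of `card_smoothSet_le`**: for `R ≥ e⁴⁰`, `R ≤ M` and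
`(2u)³ ≤ R` where `u = log M / log R` (`= 1/ν`): `|𝒞(M,R)| ≤ M (2.2 ν)^{1/ν}`. [cite: Ford2002, (4.14)] -/
theorem card_C_le_nu {M R : ℝ} (hR : Real.exp 40 ≤ R) (hRM : R ≤ M)
    (hu3 : (2 * (Real.log M / Real.log R)) ^ 3 ≤ R) :
    ((smoothSet M R).card : ℝ)
      ≤ M * (2.2 * (Real.log R / Real.log M)) ^ (Real.log M / Real.log R) := by
  have hR1 : 1 < R := lt_of_lt_of_le (by have := Real.add_one_le_exp (40:ℝ); linarith) hR
  have hM1 : 1 < M := lt_of_lt_of_le hR1 hRM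
  have hlogM : 0 < Real.log M := Real.log_pos hM1
  have hlogR : 0 < Real.log R := Real.log_pos hR1
  set u : ℝ := Real.log M / Real.log R with hu
  have hu1 : 1 ≤ u := by
    rw [hu, le_div_iff₀ hlogR, one_mul]; exact Real.log_le_log (by linarith) hRM
  have hRu : R ^ u = M := by
    rw [hu, Real.rpow_def_of_pos (by linarith), mul_div_cancel₀ _ hlogR.ne', Real.exp_log (by linarith)]
  have h := card_smoothSet_le (R := R) (u := u) hR hu1 hu3
  rw [hRu] at h
  convert h using 2
  rw [hu]; field_simp

/-! ### Sums of negative powers over an interval -/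

/-- **`∑_{a < q ≤ b} q^E ≤ b^{E+1}/(E+1)`** for `1 ≤ a ≤ b` and `-1 < E ≤ 0`.
[cite: Ford2002, proof of Lemma 4.2 ("S ≤ ∫_1^{RM^{1/h}} x^E dx ≤ (RM^{1/h})^{E+1}/(E+1)")] -/
theorem sum_Ioc_rpow_le {a b : ℕ} (ha : 1 ≤ a) (hab : a ≤ b) {E : ℝ} (hE0 : E ≤ 0) (hE1 : -1 < E) :
    ∑ q ∈ Finset.Ioc a b, (q : ℝ) ^ E ≤ (b : ℝ) ^ (E + 1) / (E + 1) := by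
  have ha0 : (0 : ℝ) < a := by exact_mod_cast ha
  -- antitone comparison with the integral
  have hanti : AntitoneOn (fun x : ℝ => x ^ E) (Set.Icc (a : ℝ) b) := by
    intro x hx y hy hxy
    exact Real.rpow_le_rpow_of_nonpos (by linarith [hx.1]) hxy hE0
  have h1 : ∑ i ∈ Finset.Ico a b, ((i + 1 : ℕ) : ℝ) ^ E ≤ ∫ x in (a : ℝ)..b, x ^ E := by
    have := AntitoneOn.sum_le_integral_Ico hab hanti
    simpa using this
  have h2 : ∑ q ∈ Finset.Ioc a b, (q : ℝ) ^ E = ∑ i ∈ Finset.Ico a b, ((i + 1 : ℕ) : ℝ) ^ E := by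
    refine (Finset.sum_nbij' (fun i => i + 1) (fun q => q - 1) ?_ ?_ ?_ ?_ ?_).symm
    · intro i hi; rw [Finset.mem_Ico] at hi; rw [Finset.mem_Ioc]; omega
    · intro q hq; rw [Finset.mem_Ioc] at hq; rw [Finset.mem_Ico]; omega
    · intro i _; omega
    · intro q hq; rw [Finset.mem_Ioc] at hq; omega
    · intro i _; rfl
  rw [h2]
  refine h1.trans ?_
  have hb0 : (0 : ℝ) < b := by exact_mod_cast lt_of_lt_of_le ha hab
  rw [integral_rpow (Or.inl hE1)]
  have hE : 0 < E + 1 := by linarith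
  rw [div_le_div_iff_of_pos_right hE]
  have : 0 ≤ (a : ℝ) ^ (E + 1) := Real.rpow_nonneg ha0.le _
  linarith


/-! ### The function `f_j = j − (j−1)/h − h(1 − α^j)` -/

/-- Ford's `f_j`. [cite: Ford2002, proof of Lemma 4.2 ("Write f_j = j − (j−1)/h − h(1−α^j)")] -/
def fj (h : ℝ) (j : ℕ) : ℝ := j - (j - 1) / h - h * (1 - (1 - 1 / h) ^ j)

/-- `f_1 = 0`. [cite: Ford2002, proof of Lemma 4.2] -/
theorem fj_one {h : ℝ} (hh : h ≠ 0) : fj h 1 = 0 := by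
  simp [fj]; field_simp; ring

/-- `f_{j+1} − f_j = α(1 − α^{j-1}) ≥ 0` for `j ≥ 1`; hence `f` is nondecreasing from `j = 1`. [folklore] -/
theorem fj_succ_sub {h : ℝ} (hh : h ≠ 0) (j : ℕ) (hj : 1 ≤ j) :
    fj h (j + 1) - fj h j = (1 - 1 / h) * (1 - (1 - 1 / h) ^ (j - 1)) := by
  obtain ⟨i, rfl⟩ : ∃ i, j = i + 1 := ⟨j - 1, by omega⟩
  simp only [fj, Nat.add_sub_cancel, pow_succ]
  push_cast
  field_simp
  ring

/-- `f_j ≥ 0` for `j ≥ 1` (`h ≥ 1`). [cite: Ford2002, proof of Lemma 4.2 ("f_1 = f_2 = 0 and f_j > 0 for j > 2")] -/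
theorem fj_nonneg {h : ℝ} (hh : 1 ≤ h) : ∀ j : ℕ, 1 ≤ j → 0 ≤ fj h j := by
  have hh0 : h ≠ 0 := by linarith
  have hα0 : 0 ≤ 1 - 1 / h := by
    have : 1 / h ≤ 1 := by rw [div_le_one (by linarith)]; exact hh
    linarith
  have hα1 : 1 - 1 / h ≤ 1 := by
    have : 0 ≤ 1 / h := by positivity
    linarith
  intro j hj
  induction j, hj using Nat.le_induction with
  | base => rw [fj_one hh0]
  | succ i hi ih =>
    have hstep := fj_succ_sub hh0 i hi
    have : 0 ≤ (1 - 1 / h) * (1 - (1 - 1 / h) ^ (i - 1)) :=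
      mul_nonneg hα0 (by have := pow_le_one₀ hα0 hα1 (n := i - 1); linarith)
    linarith

/-- `f_j ≤ (j² − j)/(2h)` for `j ≥ 2` (via (4.15)). [cite: Ford2002, proof of Lemma 4.2
("f_j ≤ (j²−2j+2)/(2h) ≤ (j²−j)/(2h)")] -/
theorem fj_le {h : ℝ} (hh : 1 ≤ h) {j : ℕ} (hj : 2 ≤ j) : fj h j ≤ ((j : ℝ) ^ 2 - j) / (2 * h) := by
  have hh0 : 0 < h := by linarith
  have h1 := alpha_pow_le_quadratic hh j
  have hj2 : (2 : ℝ) ≤ j := by exact_mod_cast hj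
  simp only [fj]
  -- `h (1 − α^j) ≥ j − j²/(2h)`
  have h2 : (j : ℝ) - (j : ℝ) ^ 2 / (2 * h) ≤ h * (1 - (1 - 1 / h) ^ j) := by
    have : h * (1 - (1 - 1 / h) ^ j) ≥ h * ((j : ℝ) / h - (j : ℝ) ^ 2 / (2 * h ^ 2)) :=
      mul_le_mul_of_nonneg_left (by linarith) hh0.le
    have e : h * ((j : ℝ) / h - (j : ℝ) ^ 2 / (2 * h ^ 2)) = j - (j : ℝ) ^ 2 / (2 * h) := by
      field_simp
    linarith
  have h3 : ((j : ℝ) ^ 2 - 2 * j + 2) / (2 * h) ≤ ((j : ℝ) ^ 2 - j) / (2 * h) :=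
    div_le_div_of_nonneg_right (by nlinarith) (by positivity)
  have e2 : (j : ℝ) - (j - 1) / h - (j - (j : ℝ) ^ 2 / (2 * h)) = ((j : ℝ) ^ 2 - 2 * j + 2) / (2 * h) := by
    field_simp; ring
  linarith

/-! ### The exponent `E` of `q` in the sum `S` -/

/-- For `1 ≤ ℓ ≤ h/2`: `h(1 − α^ℓ)/(2ℓ) ∈ [3/8, 1/2]`, i.e. `E = −1 + h(1−α^ℓ)/(2ℓ) ∈ [−5/8, −1/2]`.
[cite: Ford2002, proof of Lemma 4.2 ("it follows that −5/8 ≤ E ≤ −1/2")] -/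
theorem E_range {h : ℝ} (hh : 1 ≤ h) {ℓ : ℕ} (hℓ1 : 1 ≤ ℓ) (hℓ2 : 2 * (ℓ : ℝ) ≤ h) :
    3 / 8 ≤ h * (1 - (1 - 1 / h) ^ ℓ) / (2 * ℓ) ∧ h * (1 - (1 - 1 / h) ^ ℓ) / (2 * ℓ) ≤ 1 / 2 := by
  have hh0 : 0 < h := by linarith
  have hℓ0 : (0 : ℝ) < ℓ := by exact_mod_cast hℓ1
  have hlo := alpha_pow_ge hh ℓ
  have hhi := alpha_pow_le_quadratic hh ℓ
  constructor
  · -- lower: `1 − α^ℓ ≥ ℓ/h − ℓ²/(2h²)` so ratio `≥ 1/2 − ℓ/(4h) ≥ 1/2 − 1/8`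
    rw [le_div_iff₀ (by positivity)]
    have h1 : h * ((ℓ : ℝ) / h - (ℓ : ℝ) ^ 2 / (2 * h ^ 2)) ≤ h * (1 - (1 - 1 / h) ^ ℓ) :=
      mul_le_mul_of_nonneg_left (by linarith) hh0.le
    have e : h * ((ℓ : ℝ) / h - (ℓ : ℝ) ^ 2 / (2 * h ^ 2)) = ℓ - (ℓ : ℝ) ^ 2 / (2 * h) := by field_simp
    rw [e] at h1
    have h2 : (ℓ : ℝ) ^ 2 / (2 * h) ≤ (ℓ : ℝ) / 4 := by
      rw [div_le_div_iff₀ (by positivity) (by norm_num)]; nlinarith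
    nlinarith
  · rw [div_le_iff₀ (by positivity)]
    have h1 : h * (1 - (1 - 1 / h) ^ ℓ) ≤ h * ((ℓ : ℝ) / h) :=
      mul_le_mul_of_nonneg_left (by linarith) hh0.le
    have e : h * ((ℓ : ℝ) / h) = ℓ := by field_simp
    linarith


/-! ### Numerical constants -/

/-- `log 60 ≤ 4.1`. [folklore] -/
theorem log_sixty_le : Real.log 60 ≤ 4.1 := by
  rw [Real.log_le_iff_le_exp (by norm_num)]
  have h := Real.exp_one_gt_d9
  have e4 : Real.exp 4 = Real.exp 1 ^ 4 := by rw [← Real.exp_nat_mul]; norm_num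
  have h4 : (2.7182818283 : ℝ) ^ 4 ≤ Real.exp 1 ^ 4 := pow_le_pow_left₀ (by norm_num) h.le 4
  have h54 : (54.5 : ℝ) ≤ (2.7182818283 : ℝ) ^ 4 := by norm_num
  have e41 : Real.exp 4.1 = Real.exp 4 * Real.exp 0.1 := by rw [← Real.exp_add]; norm_num
  have h01 : (1.1 : ℝ) ≤ Real.exp 0.1 := by have := Real.add_one_le_exp (0.1 : ℝ); linarith
  rw [e41, e4]
  nlinarith [Real.exp_pos (0.1 : ℝ)]

/-- `log k ≤ 4.1 + (k − 60)/60` for `k ≥ 60` (concavity). [folklore] -/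
theorem log_le_linear {k : ℝ} (hk : 60 ≤ k) : Real.log k ≤ 4.1 + (k - 60) / 60 := by
  have h1 : Real.log k = Real.log 60 + Real.log (k / 60) := by
    rw [← Real.log_mul (by norm_num) (by positivity)]; congr 1; field_simp
  have h2 : Real.log (k / 60) ≤ k / 60 - 1 := Real.log_le_sub_one_of_pos (by positivity)
  have h3 := log_sixty_le
  rw [h1]
  have : k / 60 - 1 = (k - 60) / 60 := by field_simp
  linarith

/-- `exp 0.59 ≤ 1.818`, i.e. `log (6.6/12) ≤ −0.59`. [folklore] -/
theorem exp_059_le : Real.exp 0.59 ≤ 1.818 := by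
  have h := Real.exp_bound (x := 0.59) (by norm_num) (n := 4) (by norm_num)
  simp only [Finset.sum_range_succ, Finset.sum_range_zero, Nat.factorial] at h
  norm_num at h
  have := (abs_le.1 h).2
  linarith

/-! ### The two absorption inequalities of the induction step -/

/-- **Absorption for `T₂`**: `(8/3) k^{t(2/(hν)+2)} (2.2ν)^{t/ν} ≤ (12η)^{t/η₁}` under (4.9)–(4.12).
(Ford: `4 k^{2t(1/(hν)+1)} (2ν)^{t/ν} ≤ … ≤ (10η)^{t/η₁}`.) [cite: Ford2002, proof of Lemma 4.2 (the two displays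
after (4.14))] -/
theorem absorb_T2 {k h t : ℕ} {η ν η₁ : ℝ} (hk : 60 ≤ k) (hht : h + t = k + 1) (ht6 : 6 * t ≤ k) (ht1 : 1 ≤ t)
    (hη : 0 < η) (hν : 0 < ν) (hνη₁ : ν ≤ η₁) (hη₁ : η₁ ≤ 3 * η) (hηh : 3 * η * h ≤ 2) :
    (8 / 3 : ℝ) * (k : ℝ) ^ ((t : ℝ) * (2 / ((h : ℝ) * ν) + 2)) * (2.2 * ν) ^ ((t : ℝ) / ν)
      ≤ (12 * η) ^ ((t : ℝ) / η₁) := by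
  have hk' : (60 : ℝ) ≤ k := by exact_mod_cast hk
  have hh' : (5 : ℝ) * k ≤ 6 * ((h : ℝ) - 1) := by
    have : 6 * (h - 1) ≥ 5 * k := by omega
    have h1 : 1 ≤ h := by omega
    rw [show ((h : ℝ) - 1) = ((h - 1 : ℕ) : ℝ) by rw [Nat.cast_sub h1]; simp]
    exact_mod_cast this
  have hh0 : (50 : ℝ) < h := by linarith
  have ht0 : (1 : ℝ) ≤ t := by exact_mod_cast ht1
  have hη₁0 : 0 < η₁ := lt_of_lt_of_le hν hνη₁
  have hνh : ν ≤ 2 / h := by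
    rw [le_div_iff₀ (by linarith)]; nlinarith
  have h12η : 12 * η < 1 := by
    have : η ≤ 2 / (3 * h) := by rw [le_div_iff₀ (by positivity)]; linarith
    have : 2 / (3 * (h : ℝ)) ≤ 2 / (3 * 50) := div_le_div_of_nonneg_left (by norm_num) (by norm_num) (by linarith)
    linarith
  have hlogk := log_le_linear hk'
  have hlogk0 : 0 ≤ Real.log k := Real.log_nonneg (by linarith)
  -- work with logarithms
  have hLpos : 0 < (8 / 3 : ℝ) * (k : ℝ) ^ ((t : ℝ) * (2 / ((h : ℝ) * ν) + 2)) * (2.2 * ν) ^ ((t : ℝ) / ν) := by positivity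
  rw [← Real.log_le_log_iff hLpos (by positivity)]
  rw [Real.log_mul (by positivity) (by positivity), Real.log_mul (by positivity) (by positivity),
    Real.log_rpow (by positivity), Real.log_rpow (by positivity), Real.log_rpow (by positivity)]
  -- `(t/η₁) log(12η) ≥ (t/ν) log(12η)`
  have hlog12 : Real.log (12 * η) < 0 := Real.log_neg (by positivity) h12η
  have hstep1 : (t : ℝ) / ν * Real.log (12 * η) ≤ (t : ℝ) / η₁ * Real.log (12 * η) := by
    have : (t : ℝ) / η₁ ≤ (t : ℝ) / ν := div_le_div_of_nonneg_left (by positivity) hν hνη₁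
    nlinarith
  refine le_trans ?_ hstep1
  -- the key numerical inequality, multiplied through by `ν/t`
  have hlog83 : Real.log (8 / 3) ≤ 1 := by
    rw [Real.log_le_iff_le_exp (by norm_num)]
    have := Real.exp_one_gt_d9; linarith
  have hlogratio : Real.log (2.2 * ν) - Real.log (12 * η) ≤ -0.59 := by
    rw [← Real.log_div (by positivity) (by positivity)]
    have h1 : 2.2 * ν / (12 * η) ≤ 6.6 / 12 := by
      rw [div_le_div_iff₀ (by positivity) (by norm_num)]; nlinarith
    have h2 : Real.log (2.2 * ν / (12 * η)) ≤ Real.log (6.6 / 12) := Real.log_le_log (by positivity) h1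
    have h3 : Real.log (6.6 / 12) ≤ -0.59 := by
      rw [Real.log_le_iff_le_exp (by norm_num), Real.exp_neg, le_inv_comm₀ (by norm_num) (Real.exp_pos _)]
      linarith [exp_059_le]
    linarith
  -- `2 + 6 log k ≤ 0.59 h`
  have hmain : 2 + 6 * Real.log k ≤ 0.59 * h := by nlinarith
  -- assemble: want `log(8/3) + t(2/(hν)+2) log k + (t/ν) log(2.2ν) ≤ (t/ν) log(12η)`
  have hνt : 0 < ν / t := by positivity
  -- multiply the target by `ν/t > 0`
  rw [← sub_nonpos]
  have key : (Real.log (8 / 3) + (t : ℝ) * (2 / ((h : ℝ) * ν) + 2) * Real.log k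
      + (t : ℝ) / ν * Real.log (2.2 * ν) - (t : ℝ) / ν * Real.log (12 * η)) * (ν / t)
      = (ν / t) * Real.log (8 / 3) + (2 / h + 2 * ν) * Real.log k
        + (Real.log (2.2 * ν) - Real.log (12 * η)) := by
    field_simp
    ring
  have key2 : (ν / t) * Real.log (8 / 3) + (2 / h + 2 * ν) * Real.log k
      + (Real.log (2.2 * ν) - Real.log (12 * η)) ≤ 0 := by
    have a1 : (ν / t) * Real.log (8 / 3) ≤ 2 / h := by
      calc (ν / t) * Real.log (8 / 3) ≤ (ν / t) * 1 := mul_le_mul_of_nonneg_left hlog83 hνt.le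
        _ ≤ ν := by rw [mul_one, div_le_iff₀ (by positivity)]; nlinarith
        _ ≤ 2 / h := hνh
    have a2 : (2 / h + 2 * ν) * Real.log k ≤ (6 / h) * Real.log k := by
      refine mul_le_mul_of_nonneg_right ?_ hlogk0
      have h4 : 2 * ν ≤ 4 / h := by
        rw [le_div_iff₀ (by linarith)]; rw [le_div_iff₀ (by linarith)] at hνh; linarith
      have e6 : (2 : ℝ) / h + 4 / h = 6 / h := by ring
      linarith
    have a3 : 2 / (h : ℝ) + (6 / h) * Real.log k ≤ 0.59 := by
      rw [show (2 : ℝ) / h + 6 / h * Real.log k = (2 + 6 * Real.log k) / h by ring,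
        div_le_iff₀ (by linarith)]
      linarith
    linarith
  exact le_of_mul_le_mul_right (by rw [key, zero_mul]; exact key2) hνt


end FordVK
end Literature.NumberTheory.LFunctions
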